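import Literature.NumberTheory.GelbartRogawski1991.LocalUnitaryUndoubling
import Literature.NumberTheory.GelbartRogawski1991.LocalLeraySection
import Literature.RepresentationTheory.HeisenbergGroup.MetaplecticBoxHom
import HarnessLib

/-!
# The diagonal doubling `𝔻 = j̃ ∘ (s₁ × conj ∘ s₂) : U(V)(F_v) →* S̃p_ψ(𝕎_v ⊕ 𝕎⁻_v)` of two local homomorphisms

Topic `NumberTheory/GelbartRogawski1991`; namespace `Literature.NumberTheory.GelbartRogawski1991.UnitaryDualPair.LocalSplitting`
(that of `LocalUnitarySplittingDatum`, `LocalUnitaryUndoubling`).  KERNEL MATHEMATICS ONLY: one definition with body +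
theorems; no named fact, no `sorry`.

Setting: `F ⊂ E` number fields (`E/F` quadratic, `c` the conjugation), a finite place `v` of `F`, `V = (E^n, J)`,
`J = T₀ ⊗ 1`, the symplectic space `𝕎_v = Res V_v = F_v^n × F_v^n` with Gram matrix `T₀` and its opposite `𝕎⁻_v` (Gram
matrix `−T₀`); the doubled space `𝕎_v ⊕ 𝕎⁻_v` has Gram matrix `T₀^𝔻 = T₀ ⊕ (−T₀)` (`gramD F n T₀`, re-enumerated by
`e₂ n : Fin n ⊕ Fin n ≃ Fin (n + n)`; `localGram_gramD`).  Given TWO homomorphisms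
`s₁, s₂ : U(V)(F_v) →* S̃p_ψ(𝕎_v) = LocalMp F n T₀ v` (e.g. two local sections over two embeddings
`ι_{δ₁}, ι_{δ₂} : U(V)(F_v) → Sp(𝕎_v)`, [GelbartRogawski1991, §3.1]), the **diagonal doubling**

  `𝔻(u) := j̃(s₁ u, conj(s₂ u)) ∈ S̃p_ψ(𝕎_v ⊕ 𝕎⁻_v) = LocalMp F (n + n) (gramD F n T₀) v`

(`MpPsi.boxHom` = Kudla's `j̃` on MVW pairs, `MpPsi.conjHom : S̃p_ψ(𝕎) →* S̃p_ψ(𝕎⁻)`, [MoeglinVignerasWaldspurger1987,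
Chap. 2 II.1 Rem. (6); Chap. 4 II.1], [HarrisKudlaSweet1996, §1 (1.4), (1.9)]) is a HOMOMORPHISM
`U(V)(F_v) →* S̃p_ψ(𝕎_v ⊕ 𝕎⁻_v)` (`diagonalDoubling`) with

* `proj_diagonalDoubling` — it lies over the two-embedding diagonal `u ↦ spInl (π(s₁ u)) · spInr (π(s₂ u))`
  (`= (ι_{δ₁} u ⊕ 1)(1 ⊕ ι_{δ₂} u) ∈ Sp(𝕎_v ⊕ 𝕎⁻_v)` when `sᵢ` lies over `ι_{δᵢ}`; the second factor is `π(s₂ u)` read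
  in `Sp(𝕎⁻_v) = Sp(𝕎_v)`, `MpPsi.coe_proj_conjHom`);
* `toRep_diagonalDoubling_boxSB` — on `𝒮(F_v^{n+n}) = 𝒮(F_v^n) ⊗ 𝒮(F_v^n)` it acts by
  **`ω(𝔻 u)(f₁ ⊠ f₂) = ω(s₁ u) f₁ ⊠ conj(ω(s₂ u)(conj f₂))`**, i.e. `ω_{s₁} ⊠ ω̄_{s₂}` restricted to the diagonal
  («`ω_{V ⊗ (𝕎₂)} |_{U(V)} = ω_{s₁} ⊗ ω_{s₂}^∨` on the doubled oscillator», [HarrisKudlaSweet1996, §1 (1.4)]).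

Use (cell `hodgecm-mathlib`, row IV-4(c1) `rankOne_theta_lines_disjoint`, KEY `b4-rank-one-theta-lines-disjoint` P1/P5):
`n = 3`, `s₁, s₂` the two sections of the fact's binders; the functional `Λ` of P1 on `𝒮(F_v⁶)` is quasi-invariant
under `ω(𝔻 u)`, and P5 (`MetaplecticImplementerConjugation`) conjugates `𝔻(n_b)` onto a Siegel unipotent.  Nothing about
theta lifts is asserted here; HC_CM is proved only modulo the 7 printed citations until rung 0 of the ladder closes.

## References
* [GelbartRogawski1991] S. Gelbart, J. Rogawski, Invent. Math. 105 (1991), §3.1 p. 455.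
* [HarrisKudlaSweet1996] M. Harris, S. Kudla, W. Sweet, J. AMS 9 (1996), §1 (1.4), (1.9).
* [MoeglinVignerasWaldspurger1987] LNM 1291 (1987), Chap. 2 II.1 Rem. (6); Chap. 4 II.1.
-/

set_option autoImplicit false

noncomputable section

open NumberField IsDedekindDomain Matrix
open Literature.RepresentationTheory.HeisenbergGroup
open Literature.NumberTheory.Automorphic Literature.NumberTheory.Weil1964

namespace Literature.NumberTheory.GelbartRogawski1991.UnitaryDualPair.LocalSplitting

variable (F : Type) [Field F] [NumberField F] (E : Type) [Field E] [NumberField E] [Algebra F E] (c : E ≃ₐ[F] E)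
  (v : HeightOneSpectrum (𝓞 F)) (n : ℕ) {T₀ : Matrix (Fin n) (Fin n) F} {J : Matrix (Fin n) (Fin n) E}

/-! ## §1 The diagonal doubling -/

variable (s₁ s₂ : UnitaryGroup.localPi E c n J v →* LocalMp F n T₀ v)

/-- **The diagonal doubling `𝔻(u) = j̃(s₁ u, conj(s₂ u))`** of two homomorphisms `s₁, s₂ : U(V)(F_v) →* S̃p_ψ(𝕎_v)`:
a homomorphism `U(V)(F_v) →* S̃p_ψ(𝕎_v ⊕ 𝕎⁻_v)` — `MpPsi.boxHom (e₂ n)` composed with `(s₁, MpPsi.conjHom ∘ s₂)`.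
[cite: MoeglinVignerasWaldspurger1987, Chap. 2 II.1 Rem. (6); Chap. 4 II.1] [cite: HarrisKudlaSweet1996, §1 (1.4), (1.9)] -/
def diagonalDoubling : UnitaryGroup.localPi E c n J v →* LocalMp F (n + n) (gramD F n T₀) v :=
  (MpPsi.boxHom (e₂ n) (localGram F n T₀ v) (-(localGram F n T₀ v)) (localGram_gramD F v n T₀)
      (isLocallyConstant_of_isContinuousNontrivial (isContinuousNontrivial_adeleAddCharAt F v))
      (continuous_toLinearMap₂'_left (localGram F n T₀ v)) (continuous_toLinearMap₂'_left (-(localGram F n T₀ v)))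
      (continuous_toLinearMap₂'_left (localGram F (n + n) (gramD F n T₀) v))).comp
    (s₁.prod ((MpPsi.conjHom (isLocallyConstant_of_isContinuousNontrivial (isContinuousNontrivial_adeleAddCharAt F v))
          (localGram F n T₀ v) (continuous_toLinearMap₂'_left (localGram F n T₀ v))
      (continuous_toLinearMap₂'_left (-(localGram F n T₀ v)))).comp s₂))

/-- `𝔻(u) = boxPair (s₁ u) (conjPair (s₂ u))`. [cite: MoeglinVignerasWaldspurger1987, Chap. 2 II.1 Rem. (6)] -/
theorem diagonalDoubling_apply (u : UnitaryGroup.localPi E c n J v) :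
    diagonalDoubling F E c v n s₁ s₂ u =
      MpPsi.boxPair (e₂ n) (localGram F n T₀ v) (-(localGram F n T₀ v)) (localGram_gramD F v n T₀)
      (isLocallyConstant_of_isContinuousNontrivial (isContinuousNontrivial_adeleAddCharAt F v))
        (continuous_toLinearMap₂'_left (localGram F n T₀ v)) (continuous_toLinearMap₂'_left (-(localGram F n T₀ v)))
        (continuous_toLinearMap₂'_left (localGram F (n + n) (gramD F n T₀) v)) (s₁ u)
        (MpPsi.conjPair (isLocallyConstant_of_isContinuousNontrivial (isContinuousNontrivial_adeleAddCharAt F v))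
          (localGram F n T₀ v) (continuous_toLinearMap₂'_left (localGram F n T₀ v))
          (continuous_toLinearMap₂'_left (-(localGram F n T₀ v))) (s₂ u)) :=
  rfl

/-- **`𝔻` lies over the two-embedding diagonal**: `π(𝔻 u) = spInl (π(s₁ u)) · spInr (π(s₂ u))` (the second factor read in
`Sp(𝕎⁻_v) = Sp(𝕎_v)`). [cite: MoeglinVignerasWaldspurger1987, Chap. 2 II.1 Rem. (6)] [cite: HarrisKudlaSweet1996, §1 (1.9)] -/
theorem proj_diagonalDoubling (u : UnitaryGroup.localPi E c n J v) :
    MpPsi.proj _ (diagonalDoubling F E c v n s₁ s₂ u) =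
      spInl (e₂ n) (localGram F n T₀ v) (-(localGram F n T₀ v)) (localGram_gramD F v n T₀) (MpPsi.proj _ (s₁ u)) *
        spInr (e₂ n) (localGram F n T₀ v) (-(localGram F n T₀ v)) (localGram_gramD F v n T₀)
          (MpPsi.proj _ (MpPsi.conjHom (isLocallyConstant_of_isContinuousNontrivial (isContinuousNontrivial_adeleAddCharAt F v))
          (localGram F n T₀ v) (continuous_toLinearMap₂'_left (localGram F n T₀ v))
            (continuous_toLinearMap₂'_left (-(localGram F n T₀ v))) (s₂ u))) :=
  rfl

/-! ## §2 The action on `𝒮(F_v^{n+n}) = 𝒮(F_v^n) ⊗ 𝒮(F_v^n)` -/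

-- heartbeat margin (ops-buildfix B30 policy; lineage self-audit B-p05 g8): the `isDefEq` check of the term below runs out at
-- `maxHeartbeats 160000` (green at the 200000 default) — budget doubled so a Mathlib bump does not turn it into a build cliff.
set_option maxHeartbeats 400000 in
/-- **`ω(𝔻 u)(f₁ ⊠ f₂) = ω(s₁ u) f₁ ⊠ conj(ω(s₂ u)(conj f₂))`** — the doubled oscillator restricted to the diagonal is
`ω_{s₁} ⊠ ω̄_{s₂}`. [cite: HarrisKudlaSweet1996, §1 (1.4)] [cite: MoeglinVignerasWaldspurger1987, Chap. 2 II.1 Rem. (6); Chap. 4 II.1] -/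
theorem toRep_diagonalDoubling_boxSB (u : UnitaryGroup.localPi E c n J v) (f₁ f₂ : SchwartzBruhat (Fin n → v.adicCompletion F)) :
    MpPsi.toRep (localSchrodinger F (n + n) (gramD F n T₀) v) (diagonalDoubling F E c v n s₁ s₂ u) (boxSB (v.adicCompletion F) (e₂ n) f₁ f₂) =
      boxSB (v.adicCompletion F) (e₂ n) (MpPsi.toRep (localSchrodinger F n T₀ v) (s₁ u) f₁)
        (conjSB (MpPsi.toRep (localSchrodinger F n T₀ v) (s₂ u) (conjSB f₂))) :=
  (MpPsi.toRep_boxHom_boxSB (e₂ n) (localGram F n T₀ v) (-(localGram F n T₀ v)) (localGram_gramD F v n T₀)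
      (isLocallyConstant_of_isContinuousNontrivial (isContinuousNontrivial_adeleAddCharAt F v))
    (continuous_toLinearMap₂'_left (localGram F n T₀ v)) (continuous_toLinearMap₂'_left (-(localGram F n T₀ v)))
    (continuous_toLinearMap₂'_left (localGram F (n + n) (gramD F n T₀) v)) (s₁ u)
    (MpPsi.conjHom (isLocallyConstant_of_isContinuousNontrivial (isContinuousNontrivial_adeleAddCharAt F v))
          (localGram F n T₀ v) (continuous_toLinearMap₂'_left (localGram F n T₀ v))
      (continuous_toLinearMap₂'_left (-(localGram F n T₀ v))) (s₂ u)) f₁ f₂).trans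
    (by rw [MpPsi.toRep_conjHom]; rfl)

/-- the operator of `𝔻 u` is `op(s₁ u) ⊠ conj ∘ op(s₂ u) ∘ conj`. [cite: MoeglinVignerasWaldspurger1987, Chap. 2 II.1 Rem. (6); Chap. 4 II.1] -/
theorem toOp_diagonalDoubling (u : UnitaryGroup.localPi E c n J v) :
    MpPsi.toOp _ (diagonalDoubling F E c v n s₁ s₂ u) =
      boxEquivSB (v.adicCompletion F) (e₂ n) (MpPsi.toOp _ (s₁ u)) (conjOp (MpPsi.toOp _ (s₂ u))) :=
  rfl

/-- **implementers of the doubled model are unique up to scalar** (`det T₀^𝔻 = ± (det T₀)²` a unit): the hypothesis `hU`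
of `MetaplecticImplementerConjugation` at `ρ = localSchrodinger F (n + n) (gramD F n T₀) v`.
[cite: MoeglinVignerasWaldspurger1987, Chap. 2 II.1 (A)] -/
theorem implementerUniqueUpToScalar_localSchrodinger_gramD (hT₀d : IsUnit T₀.det) :
    ImplementerUniqueUpToScalar (localSchrodinger F (n + n) (gramD F n T₀) v) :=
  implementerUniqueUpToScalar_localSchrodinger F (n + n) (gramD F n T₀) (isUnit_det_gramD F n hT₀d) v

end Literature.NumberTheory.GelbartRogawski1991.UnitaryDualPair.LocalSplitting

end
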